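/-
Copyright: the b2b-balaban T⁴-continuum CRUX team, row NE7b OWNER lineage `t4-ne7b-p1` (gen 129). Project licence.
-/
import Mathlib.Analysis.Calculus.Deriv.Comp
import Mathlib.Analysis.Calculus.Deriv.Mul
import Mathlib.Analysis.Calculus.Deriv.Add
import Mathlib.Analysis.Calculus.Deriv.Slope
import Mathlib.LinearAlgebra.Matrix.DotProduct
import Mathlib.Topology.Algebra.Order.LiminfLimsup

/-!
# THE GAUSSIAN-ROAD ACTION IS JOINTLY CONVEX IN (FLUCTUATION, EXTERNAL FIELD) AFTER THE QUADRATIC SHIFT `λ_w·Σψ²`: for a symmetric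
# precision `M` with floor `m·Σz² ≤ ⟨z,Mz⟩` and remainders with the LOWER first-order letter `w_x(b) ≥ w_x(a) + w'_x(a)(b−a) − ½λ_w(b−a)²`
# (`0 ≤ λ_w`, `2λ_w ≤ m`), the function `S_ψ(z) = ½⟨z,Mz⟩ + Σ_{p∈C}Σ_{x∈cell p}w_x(z_x+ψ_x) + λ_wΣ_{p∈C}Σ_{x∈cell p}ψ_x²` satisfies the SECANT
# letter jointly in `(z, ψ)`: `(1−s)S_{ψ₀}(x) + sS_{ψ₁}(y) ≥ S_{ψ_s}(z_s)` — the pointwise hypothesis of Prékopa–Leindler; plus the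
# passage «secant letter + differentiability ⟹ first-order letter» on any real normed space (row NE7b, node U5c; elementary; [folklore])

Cell `pub-balaban`, sub-cell `t4`, spine estimate NE7b (`T4WeightBudget.RelWeightBound`; the cell's OWN estimate — NOT PRINTED in
[Bałaban 1983–89], NOT PROVED).  Crux-route work under `Spine/NE7b/` by the row OWNER (`t4-ne7b-p1` gen 129, file (317)) under FREEZE
(0)'s crux-prover clause, on § [NE7bP1-G129-HANDOFF] NEXT (3)(a) (the LOWER second-order letter of the next potential by Prékopa–Leindler);
NOTHING of Bałaban's is named as a Lean object, valued or asserted; no `T4Continuum/Support` leaf typed; no `def`, no notation; zero `sorry`.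
Imports: Mathlib only (`Matrix.dotProduct_transpose_mulVec`, `HasFDerivAt.comp_hasDerivAt`, `HasDerivAt.tendsto_slope_zero_right`).

WHY (located).  (316) transported the UPPER curvature of the remainders to the next potential by Jensen; the LOWER curvature (a stability
floor for `−log Z_ψ`) does not pass through Jensen.  It passes through PRÉKOPA–LEINDLER: the marginal of a log-concave density is
log-concave, so if `(z, ψ) ↦ ½⟨z,Mz⟩ + V(ψ,z) + λ_w|ψ|²` is jointly convex then `ψ ↦ −log ∫e^{−½⟨z,Mz⟩−V(ψ,z)}dz + λ_w|ψ|²` is convex — a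
lower letter with constant `2λ_w`.  Joint convexity is exactly the budget `½m|x−y|² − ½λ_wΣ(a−b)² + λ_wΣ(ψ₀−ψ₁)² ≥ 0` with
`(a−b)² ≤ 2(x−y)² + 2(ψ₀−ψ₁)²`, i.e. `2λ_w ≤ m`: the Gaussian mass must dominate twice the remainders' negative curvature — the road's
regime `κγ_op < 1` again.  This file is the algebra; (318) is the measure side.

WHAT IS PROVED ([folklore]):
* §1 `secant_of_lowerLetter` (1-D: `f(b) ≥ f(a) + f'(a)(b−a) − ½λ(b−a)²` ⟹ `(1−s)f(a) + sf(b) ≥ f((1−s)a+sb) − ½λs(1−s)(a−b)²`);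
* §2 `dotProduct_mulVec_symm`, `quadForm_add` (`⟨a+d,M(a+d)⟩ = ⟨a,Ma⟩ + 2⟨d,Ma⟩ + ⟨d,Md⟩`), **`quadForm_secant`**
  (`(1−s)½⟨x,Mx⟩ + s½⟨y,My⟩ ≥ ½⟨z_s,Mz_s⟩ + ½m·s(1−s)Σ(x−y)²` under the floor `m`);
* §3 THE JOINT SECANT LETTER **`jointAction_secant`**: `2λ_w ≤ m` ⟹ `(1−s)S_{ψ₀}(x) + sS_{ψ₁}(y) ≥ S_{ψ_s}(z_s)` for all `x, y, ψ₀, ψ₁`, `0 ≤ s ≤ 1`;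
* §4 **`firstOrder_of_secant_hasFDerivAt'`** (any real normed space: secant letter along the segment with a constant gain `R` + `HasFDerivAt W L w`
  ⟹ `W w + L(w'−w) + ½μR ≤ W w'`); §5 toy.

HONEST (what this is NOT).  Finite-dimensional calculus only; the measure side (Prékopa–Leindler, the Gaussian dictionary, the lower letter
of `−log Z_ψ`) is (318); scalar skeleton ((A3), NC-NE7b-α UNRULED); nothing of Bałaban's asserted.  BY-NAME EFFECT ON THE WALL: NONE.  NE7b NOT
PRINTED ∕ NOT PROVED; spine PROVED 0∕9; rung (B)+1 — the programme's measures remain FINITE-torus statements; NOT the mass gap, NOT Clay.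
HONEST DEPENDENCY: continuum YM on T⁴ ⇐ BetaPertH ∧ nine spine estimates (0∕9 proved); BetaPertH ⇐ (D1) ∧ (D4) ∧ CAP+tail; G-an2-4 gates
asym, D1 and NE2∕3∕4.
-/

set_option autoImplicit false

noncomputable section

namespace Summit.QuantumFields.BalabanUV.T4Continuum.NE7b.SupJointConvexity

open Finset Filter
open scoped BigOperators Topology Matrix

variable {ι : Type} [Fintype ι] {V : Type*}

/-! ## §1. One dimension: lower first-order letter ⟹ secant letter -/

/-- **LOWER FIRST-ORDER LETTER ⟹ SECANT LETTER** (one variable): `f(b) ≥ f(a) + f'(a)(b−a) − ½λ(b−a)²` for all `a, b` ⟹ for `0 ≤ s ≤ 1`,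
`(1−s)f(a) + sf(b) ≥ f((1−s)a + sb) − ½λ·s(1−s)(a−b)²`. [folklore] -/
theorem secant_of_lowerLetter {f f' : ℝ → ℝ} {lam : ℝ} (hflo : ∀ a b : ℝ, f a + f' a * (b - a) - lam / 2 * (b - a) ^ 2 ≤ f b)
    (a b : ℝ) {s : ℝ} (hs0 : 0 ≤ s) (hs1 : s ≤ 1) :
    f ((1 - s) * a + s * b) - lam / 2 * (s * (1 - s)) * (a - b) ^ 2 ≤ (1 - s) * f a + s * f b := by
  set c : ℝ := (1 - s) * a + s * b with hc
  have h1 := hflo c a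
  have h2 := hflo c b
  have e1 : a - c = s * (a - b) := by rw [hc]; ring
  have e2 : b - c = (1 - s) * (b - a) := by rw [hc]; ring
  rw [e1] at h1
  rw [e2] at h2
  have k := add_le_add (mul_le_mul_of_nonneg_left h1 (sub_nonneg.2 hs1)) (mul_le_mul_of_nonneg_left h2 hs0)
  have e : (1 - s) * (f c + f' c * (s * (a - b)) - lam / 2 * (s * (a - b)) ^ 2) +
      s * (f c + f' c * ((1 - s) * (b - a)) - lam / 2 * ((1 - s) * (b - a)) ^ 2) =
      f c - lam / 2 * (s * (1 - s)) * (a - b) ^ 2 := by ring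
  linarith

/-! ## §2. The quadratic form: symmetric with a floor ⟹ secant letter with gain `m` -/

/-- For symmetric `M`: `⟨x, My⟩ = ⟨y, Mx⟩`. [folklore] -/
theorem dotProduct_mulVec_symm {M : Matrix ι ι ℝ} (hM : Mᵀ = M) (x y : ι → ℝ) : x ⬝ᵥ (M *ᵥ y) = y ⬝ᵥ (M *ᵥ x) := by
  rw [← Matrix.dotProduct_transpose_mulVec M y x, hM]

/-- **Expansion of the quadratic form of a sum** (symmetric `M`): `⟨a+d, M(a+d)⟩ = ⟨a,Ma⟩ + 2⟨d,Ma⟩ + ⟨d,Md⟩`. [folklore] -/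
theorem quadForm_add {M : Matrix ι ι ℝ} (hM : Mᵀ = M) (a d : ι → ℝ) :
    (a + d) ⬝ᵥ (M *ᵥ (a + d)) = a ⬝ᵥ (M *ᵥ a) + 2 * (d ⬝ᵥ (M *ᵥ a)) + d ⬝ᵥ (M *ᵥ d) := by
  rw [Matrix.mulVec_add, add_dotProduct, dotProduct_add, dotProduct_add, dotProduct_mulVec_symm hM a d]
  ring

/-- **THE SECANT LETTER OF THE QUADRATIC FORM WITH A FLOOR**: `Mᵀ = M`, `m·Σz_i² ≤ ⟨z,Mz⟩` ⟹ for `0 ≤ s ≤ 1` and `z_s = (1−s)x + sy`,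
`½⟨z_s,Mz_s⟩ + ½m·s(1−s)·Σ(x_i−y_i)² ≤ (1−s)·½⟨x,Mx⟩ + s·½⟨y,My⟩`. [folklore] -/
theorem quadForm_secant {M : Matrix ι ι ℝ} (hM : Mᵀ = M) {m : ℝ} (hfl : ∀ z : ι → ℝ, m * ∑ i, z i ^ 2 ≤ z ⬝ᵥ (M *ᵥ z))
    (x y : ι → ℝ) {s : ℝ} (hs0 : 0 ≤ s) (hs1 : s ≤ 1) :
    1 / 2 * (((1 - s) • x + s • y) ⬝ᵥ (M *ᵥ ((1 - s) • x + s • y))) + m / 2 * (s * (1 - s)) * ∑ i, (x i - y i) ^ 2 ≤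
      (1 - s) * (1 / 2 * (x ⬝ᵥ (M *ᵥ x))) + s * (1 / 2 * (y ⬝ᵥ (M *ᵥ y))) := by
  set zs : ι → ℝ := (1 - s) • x + s • y with hzs
  -- expand `x` and `y` about `z_s`
  have ex : x = zs + s • (x - y) := by funext i; simp only [hzs, Pi.add_apply, Pi.smul_apply, Pi.sub_apply, smul_eq_mul]; ring
  have ey : y = zs + (1 - s) • (y - x) := by funext i; simp only [hzs, Pi.add_apply, Pi.smul_apply, Pi.sub_apply, smul_eq_mul]; ring
  have hx : x ⬝ᵥ (M *ᵥ x) = zs ⬝ᵥ (M *ᵥ zs) + 2 * ((s • (x - y)) ⬝ᵥ (M *ᵥ zs)) + (s • (x - y)) ⬝ᵥ (M *ᵥ (s • (x - y))) := by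
    conv_lhs => rw [ex]
    exact quadForm_add hM zs _
  have hy : y ⬝ᵥ (M *ᵥ y) = zs ⬝ᵥ (M *ᵥ zs) + 2 * (((1 - s) • (y - x)) ⬝ᵥ (M *ᵥ zs)) +
      ((1 - s) • (y - x)) ⬝ᵥ (M *ᵥ ((1 - s) • (y - x))) := by
    conv_lhs => rw [ey]
    exact quadForm_add hM zs _
  -- the linear terms cancel, the quadratic remainders carry the floor
  have hlin : (1 - s) * ((s • (x - y)) ⬝ᵥ (M *ᵥ zs)) + s * (((1 - s) • (y - x)) ⬝ᵥ (M *ᵥ zs)) = 0 := by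
    have e : (1 - s) • (y - x) = -((1 - s) • (x - y)) := by rw [← smul_neg, neg_sub]
    rw [e, neg_dotProduct, smul_dotProduct, smul_dotProduct, smul_eq_mul, smul_eq_mul]
    ring
  have hq1 : (s • (x - y)) ⬝ᵥ (M *ᵥ (s • (x - y))) = s ^ 2 * ((x - y) ⬝ᵥ (M *ᵥ (x - y))) := by
    rw [Matrix.mulVec_smul, dotProduct_smul, smul_dotProduct, smul_eq_mul, smul_eq_mul]; ring
  have hq2 : ((1 - s) • (y - x)) ⬝ᵥ (M *ᵥ ((1 - s) • (y - x))) = (1 - s) ^ 2 * ((x - y) ⬝ᵥ (M *ᵥ (x - y))) := by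
    have e : y - x = -(x - y) := (neg_sub x y).symm
    rw [Matrix.mulVec_smul, dotProduct_smul, smul_dotProduct, smul_eq_mul, smul_eq_mul, e, Matrix.mulVec_neg, neg_dotProduct,
      dotProduct_neg, neg_neg]
    ring
  have hfloor := hfl (x - y)
  simp only [Pi.sub_apply] at hfloor
  have hs1' : 0 ≤ 1 - s := sub_nonneg.2 hs1
  have hss : 0 ≤ s * (1 - s) := mul_nonneg hs0 hs1'
  -- assemble
  have key : (1 - s) * (x ⬝ᵥ (M *ᵥ x)) + s * (y ⬝ᵥ (M *ᵥ y)) =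
      zs ⬝ᵥ (M *ᵥ zs) + (s * (1 - s)) * ((x - y) ⬝ᵥ (M *ᵥ (x - y))) := by
    rw [hx, hy, hq1, hq2]
    have := hlin
    nlinarith [hlin]
  nlinarith [key, mul_le_mul_of_nonneg_left hfloor hss]

/-! ## §3. The joint secant letter of the Gaussian-road action -/

omit [Fintype ι] in
/-- The shift term: `(1−s)ψ₀² + sψ₁² − ψ_s² = s(1−s)(ψ₀−ψ₁)²` summed over the cells. [folklore] -/
theorem shift_secant (cell : V → Finset ι) (C : Finset V) (ψ₀ ψ₁ : ι → ℝ) (s : ℝ) :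
    (1 - s) * ∑ p ∈ C, ∑ u ∈ cell p, ψ₀ u ^ 2 + s * ∑ p ∈ C, ∑ u ∈ cell p, ψ₁ u ^ 2 -
        ∑ p ∈ C, ∑ u ∈ cell p, ((1 - s) * ψ₀ u + s * ψ₁ u) ^ 2 =
      s * (1 - s) * ∑ p ∈ C, ∑ u ∈ cell p, (ψ₀ u - ψ₁ u) ^ 2 := by
  simp only [mul_sum, ← sum_sub_distrib, ← sum_add_distrib]
  refine sum_congr rfl fun p _ => sum_congr rfl fun u _ => ?_
  ring

omit [Fintype ι] in
/-- A double sum over pairwise disjoint cells of nonnegative terms is at most the full sum. [folklore] -/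
theorem cellSum_le_univ_sum [Fintype ι] [DecidableEq ι] (cell : V → Finset ι) (hdisj : ∀ p q, p ≠ q → Disjoint (cell p) (cell q))
    (C : Finset V) (f : ι → ℝ) (hf : ∀ i, 0 ≤ f i) : ∑ p ∈ C, ∑ u ∈ cell p, f u ≤ ∑ i, f i := by
  have hpd : (C : Set V).PairwiseDisjoint cell := fun p _ q _ hpq => hdisj p q hpq
  rw [← sum_biUnion hpd]
  exact sum_le_sum_of_subset_of_nonneg (subset_univ _) fun i _ _ => hf i

/-- **THE JOINT SECANT LETTER.**  `Mᵀ = M` with floor `m·Σz² ≤ ⟨z,Mz⟩`; pairwise disjoint cells; remainders with the lower first-order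
letter `w_x(a) + w'_x(a)(b−a) − ½λ_w(b−a)² ≤ w_x(b)` (`0 ≤ λ_w`); `2λ_w ≤ m` ⟹ for all `x, y : ι → ℝ`, all `ψ₀, ψ₁` and `0 ≤ s ≤ 1`, with
`S_ψ(z) = ½⟨z,Mz⟩ + Σ_{p∈C}Σ_{u∈cell p}w_u(z_u+ψ_u) + λ_wΣ_{p∈C}Σ_{u∈cell p}ψ_u²`:
`S_{(1−s)ψ₀+sψ₁}((1−s)x+sy) ≤ (1−s)S_{ψ₀}(x) + sS_{ψ₁}(y)`. [folklore] -/
theorem jointAction_secant [DecidableEq ι] {M : Matrix ι ι ℝ} (hM : Mᵀ = M) {m : ℝ}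
    (hfl : ∀ z : ι → ℝ, m * ∑ i, z i ^ 2 ≤ z ⬝ᵥ (M *ᵥ z)) (cell : V → Finset ι)
    (hdisj : ∀ p q, p ≠ q → Disjoint (cell p) (cell q)) {w w' : ι → ℝ → ℝ} {lamw : ℝ} (hlamw : 0 ≤ lamw)
    (hwlo : ∀ u (a b : ℝ), w u a + w' u a * (b - a) - lamw / 2 * (b - a) ^ 2 ≤ w u b) (hm : 2 * lamw ≤ m) (C : Finset V)
    (x y ψ₀ ψ₁ : ι → ℝ) {s : ℝ} (hs0 : 0 ≤ s) (hs1 : s ≤ 1) :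
    1 / 2 * (((1 - s) • x + s • y) ⬝ᵥ (M *ᵥ ((1 - s) • x + s • y))) +
        ∑ p ∈ C, ∑ u ∈ cell p, w u (((1 - s) • x + s • y) u + ((1 - s) * ψ₀ u + s * ψ₁ u)) +
        lamw * ∑ p ∈ C, ∑ u ∈ cell p, ((1 - s) * ψ₀ u + s * ψ₁ u) ^ 2 ≤
      (1 - s) * (1 / 2 * (x ⬝ᵥ (M *ᵥ x)) + ∑ p ∈ C, ∑ u ∈ cell p, w u (x u + ψ₀ u) + lamw * ∑ p ∈ C, ∑ u ∈ cell p, ψ₀ u ^ 2) +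
        s * (1 / 2 * (y ⬝ᵥ (M *ᵥ y)) + ∑ p ∈ C, ∑ u ∈ cell p, w u (y u + ψ₁ u) + lamw * ∑ p ∈ C, ∑ u ∈ cell p, ψ₁ u ^ 2) := by
  have hs1' : 0 ≤ 1 - s := sub_nonneg.2 hs1
  have hss : 0 ≤ s * (1 - s) := mul_nonneg hs0 hs1'
  -- (i) the quadratic form
  have hQ := quadForm_secant hM hfl x y hs0 hs1
  -- (ii) the remainders, site by site
  have hW : ∑ p ∈ C, ∑ u ∈ cell p, w u (((1 - s) • x + s • y) u + ((1 - s) * ψ₀ u + s * ψ₁ u)) -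
      lamw / 2 * (s * (1 - s)) * ∑ p ∈ C, ∑ u ∈ cell p, ((x u + ψ₀ u) - (y u + ψ₁ u)) ^ 2 ≤
      (1 - s) * ∑ p ∈ C, ∑ u ∈ cell p, w u (x u + ψ₀ u) + s * ∑ p ∈ C, ∑ u ∈ cell p, w u (y u + ψ₁ u) := by
    rw [mul_sum, mul_sum, mul_sum, ← sum_sub_distrib, ← sum_add_distrib]
    refine sum_le_sum fun p _ => ?_
    rw [mul_sum, mul_sum, mul_sum, ← sum_sub_distrib, ← sum_add_distrib]
    refine sum_le_sum fun u _ => ?_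
    have h := secant_of_lowerLetter (hwlo u) (x u + ψ₀ u) (y u + ψ₁ u) hs0 hs1
    have e : (1 - s) * (x u + ψ₀ u) + s * (y u + ψ₁ u) = ((1 - s) • x + s • y) u + ((1 - s) * ψ₀ u + s * ψ₁ u) := by
      simp only [Pi.add_apply, Pi.smul_apply, smul_eq_mul]; ring
    rw [e] at h
    linarith
  -- (iii) the shift
  have hS := shift_secant cell C ψ₀ ψ₁ s
  -- (iv) the budget: `½λ_w·Σ(a−b)² ≤ λ_wΣ(x−y)² + λ_wΣ(ψ₀−ψ₁)²`, `λ_wΣ_{cells}(x−y)² ≤ ½m·Σ_i(x−y)²`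
  have hab : ∑ p ∈ C, ∑ u ∈ cell p, ((x u + ψ₀ u) - (y u + ψ₁ u)) ^ 2 ≤
      2 * ∑ p ∈ C, ∑ u ∈ cell p, (x u - y u) ^ 2 + 2 * ∑ p ∈ C, ∑ u ∈ cell p, (ψ₀ u - ψ₁ u) ^ 2 := by
    rw [mul_sum, mul_sum, ← sum_add_distrib]
    refine sum_le_sum fun p _ => ?_
    rw [mul_sum, mul_sum, ← sum_add_distrib]
    refine sum_le_sum fun u _ => ?_
    nlinarith [sq_nonneg ((x u - y u) - (ψ₀ u - ψ₁ u))]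
  have hcells := cellSum_le_univ_sum cell hdisj C (fun i => (x i - y i) ^ 2) fun i => sq_nonneg _
  have h0 : 0 ≤ ∑ p ∈ C, ∑ u ∈ cell p, (ψ₀ u - ψ₁ u) ^ 2 := sum_nonneg fun p _ => sum_nonneg fun u _ => sq_nonneg _
  have h1 : 0 ≤ ∑ i, (x i - y i) ^ 2 := sum_nonneg fun i _ => sq_nonneg _
  nlinarith [hQ, hW, hS, mul_le_mul_of_nonneg_left hab (by positivity : 0 ≤ lamw / 2 * (s * (1 - s))),
    mul_le_mul_of_nonneg_left hcells (by positivity : 0 ≤ lamw * (s * (1 - s))),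
    mul_le_mul_of_nonneg_left hm (mul_nonneg hss h1)]

/-! ## §4. Secant letter + differentiability ⟹ first-order letter (any real normed space) -/

/-- **SECANT LETTER + DIFFERENTIABILITY AT THE BASE POINT ⟹ FIRST-ORDER LETTER** on a real normed space: if
`W(w + s(w′−w)) + ½μ·s(1−s)R ≤ (1−s)W w + sW w′` for `0 < s < 1` and `HasFDerivAt W L w`, then `W w + L(w′−w) + ½μR ≤ W w′`
(`R` any constant — for the sockets, `Σ(w′−w)²`). [folklore] -/
theorem firstOrder_of_secant_hasFDerivAt' {E : Type*} [NormedAddCommGroup E] [NormedSpace ℝ E] {W : E → ℝ} {μ R : ℝ} {w w' : E}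
    {L : E →L[ℝ] ℝ} (hd : HasFDerivAt W L w)
    (hsec : ∀ s : ℝ, 0 < s → s < 1 → W (w + s • (w' - w)) + μ / 2 * s * (1 - s) * R ≤ (1 - s) * W w + s * W w') :
    W w + L (w' - w) + μ / 2 * R ≤ W w' := by
  have hline : HasDerivAt (fun t : ℝ => w + t • (w' - w)) (w' - w) 0 := by
    simpa using HasDerivAt.const_add w (HasDerivAt.smul_const (hasDerivAt_id (0 : ℝ)) (w' - w))
  have hd0 : HasFDerivAt W L ((fun t : ℝ => w + t • (w' - w)) 0) := by simpa using hd
  have hslope := (HasFDerivAt.comp_hasDerivAt (0 : ℝ) hd0 hline).tendsto_slope_zero_right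
  have hev : ∀ᶠ t in nhdsWithin (0 : ℝ) (Set.Ioi 0),
      t⁻¹ • ((W ∘ fun t : ℝ => w + t • (w' - w)) (0 + t) - (W ∘ fun t : ℝ => w + t • (w' - w)) 0) ≤
        W w' - W w - (1 - t) * (μ / 2 * R) := by
    filter_upwards [Ioo_mem_nhdsGT (zero_lt_one' ℝ)] with t ht
    have h := hsec t ht.1 ht.2
    simp only [Function.comp_apply, zero_add, zero_smul, add_zero, smul_eq_mul]
    rw [inv_mul_le_iff₀ ht.1]
    nlinarith [h, ht.1]
  have hrhs : Tendsto (fun t : ℝ => W w' - W w - (1 - t) * (μ / 2 * R)) (nhdsWithin (0 : ℝ) (Set.Ioi 0))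
      (𝓝 (W w' - W w - (1 - 0) * (μ / 2 * R))) :=
    ((continuous_const.sub ((continuous_const.sub continuous_id).mul continuous_const)).tendsto 0).mono_left
      nhdsWithin_le_nhds
  have key := le_of_tendsto_of_tendsto hslope hrhs hev
  linarith

/-! ## §5. Toy -/

/-- Toy (§1): the ZERO function has the lower letter with `λ = 0`, so the secant letter holds with no defect. -/
example (a b : ℝ) : (fun _ : ℝ => (0 : ℝ)) ((1 - 1 / 2) * a + 1 / 2 * b) - 0 / 2 * (1 / 2 * (1 - 1 / 2)) * (a - b) ^ 2 ≤
    (1 - 1 / 2) * (fun _ : ℝ => (0 : ℝ)) a + 1 / 2 * (fun _ : ℝ => (0 : ℝ)) b :=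
  secant_of_lowerLetter (f := fun _ => 0) (f' := fun _ => 0) (fun a b => by simp) a b (by norm_num) (by norm_num)

end Summit.QuantumFields.BalabanUV.T4Continuum.NE7b.SupJointConvexity
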